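/-
Copyright: the b2b-balaban T⁴-continuum CRUX team, row NE7b OWNER lineage `t4-ne7b-p1` (gen 141). Project licence.
-/
import Summits.QuantumFields.BalabanUV.T4Continuum.Spine.NE7b.SupFourthCumulantTree
import Summits.QuantumFields.BalabanUV.T4Continuum.Spine.NE7b.SupWhitenedThirdCumulantRaw
import Summits.QuantumFields.BalabanUV.T4Continuum.Spine.NE7b.SupCrossWeightedCovarianceDecay

/-!
# THE FOURTH CUMULANT OF THE FLUCTUATION STEP'S GRADIENT COMPONENTS HAS TREE DECAY, GENERAL `Γ = AAᵀ` (SCOPING (d13)(2), tenth file):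
# (496) instantiated for the whitened gradient components `F_v(ξ) = U′(Aξ+ψ)[e_v]` tilted against `N(0,AAᵀ)` in whitened coordinates, exactly as
# (467) instantiated (461).  With an admissible `D` carrying weighted letters `dθ, dθ′` against a sampler weight `θ ≥ 0`, a compatible cross
# weight `σ ≥ 0`, a SITE weight `r ≥ 1` with `r²⁴ ≤ σσ`, and the weighted profiles `αθ, βθ` of the observables, (466) gives the decay
# `B(b^v,b^{v′}) ≤ K∕r_{vv′}²⁴`, `K = αθ·dθ·βθ·dθ′∕(1−lamA)`; (465) gives `M₄ = 5κ₂⁴γ_op²∕(1−λγ_op)²` and `M₂ = (M₄+1)∕2`; the SIXTH moment `M₆`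
# is a LETTER (hypothesis).  Then for every four sites `x, y, z, t`:
#   `|u₄(F_x,F_y,F_z,F_t)| ≤ (4K + 3K² + 4M₄ + 4M₆ + 2M₂(M₂+M₄))·Σ_{T} Π_{e∈T} r_e⁻²`   (sixteen labelled spanning trees)
# — UNIFORM IN THE BACKGROUND AND THE VOLUME; the cumulant piece of `∂⁴W`'s kernel letter for the road's singular finite-range `Γ` (row NE7b,
# node U5c; (496), (466), (465), (457), (458), (456) BY NAME; [folklore])

Cell `pub-balaban`, sub-cell `t4`, spine estimate NE7b (`T4WeightBudget.RelWeightBound`; the cell's OWN estimate — NOT PRINTED in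
[Bałaban 1983–89], NOT PROVED).  Crux-route work under `Spine/NE7b/` by the row OWNER (`t4-ne7b-p1` gen 141, file (497)) under FREEZE
(0)'s crux-prover clause; NOTHING of Bałaban's is named as a Lean object, valued or asserted; no `T4Continuum/Support` leaf typed; no
`def`, no notation (`u₄` and the tree sum WRITTEN OUT); zero `sorry`.  Imports (BY NAME): the OWNER's (496) `…SupFourthCumulantTree`
(`fourth_cumulant_tree_bound`), (467) `…SupWhitenedThirdCumulantRaw` (for its imports: (457) `whitenedV_*`, `whitened_integrable_lebesgue`,
(458) `whitened_exp_integrable`, `whitened_second_moment_integrable`, (465) `whitened_fourth_moment_gibbs`, `whitened_fourth_power_integrable`,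
(456) `whitened_obs_lipVec`, `whitened_obs_nonneg`, `whitened_cross_nonneg`, `whitened_J_rowsum_le`), (466) `…SupCrossWeightedCovarianceDecay`
(`cross_bilinear_decay`).

WHAT IS PROVED ([folklore]): `second_le_of_fourth` (`∫f² ≤ (∫f⁴+1)∕2`), THE END **`whitened_fourth_cumulant_tree`**; toy.

HONEST (what this is NOT).  The cumulant PIECE at order 4 with `M₆` a LETTER (its discharge: (423)'s Gaussian moments up to `|φ|¹²`, then
Poincaré on `(g−μ)³` as (465)); the site-indexed ROW letter (`Σ_{y,z,t}` via (488), `r` symmetric) and the geometry instantiation ((476)'s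
weights with `σ = e^{12μd}`, `r = e^{μd}`) are immediate successors; the average∕two-point∕three-point pieces of `∂⁴W` and its cumulant FORM
(`U ∈ C⁴`) are NOT typed; scalar skeleton ((A3), NC-NE7b-α UNRULED); nothing of Bałaban's asserted.  BY-NAME EFFECT ON THE WALL: NONE.  NE7b
NOT PRINTED ∕ NOT PROVED; spine PROVED 0∕9; rung (B)+1 — the programme's measures remain FINITE-torus statements; NOT the mass gap, NOT Clay.
HONEST DEPENDENCY: continuum YM on T⁴ ⇐ BetaPertH ∧ nine spine estimates (0∕9 proved); BetaPertH ⇐ (D1) ∧ (D4) ∧ CAP+tail; G-an2-4 gates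
asym, D1 and NE2∕3∕4.
-/

set_option autoImplicit false
set_option maxSynthPendingDepth 2

noncomputable section

namespace Summit.QuantumFields.BalabanUV.T4Continuum.NE7b.SupWhitenedFourthCumulantTree

open MeasureTheory ProbabilityTheory Real Set Function Finset Matrix
open scoped BigOperators
open Literature.Probability.Distributions (matrixCLM)
open SupFourthCumulantTree (fourth_cumulant_tree_bound)
open SupCrossWeightedCovarianceDecay (cross_bilinear_decay)
open SupWhitenedMomentLetters (whitened_exp_integrable whitened_second_moment_integrable)
open SupWhitenedCovarianceKernelLetter (whitenedV_hasDerivAt whitenedV_floor whitenedV_ceiling whitenedV_cross whitenedV_continuous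
  whitened_integrable_lebesgue)
open SupWhitenedFirstOrderLetters (whitened_obs_lipVec whitened_cross_nonneg whitened_J_rowsum_le whitened_obs_nonneg)
open SupWhitenedFourthMoment (whitened_fourth_moment_gibbs whitened_fourth_power_integrable)

/-! ## §1. The second moment from the fourth -/

/-- `∫f² ≤ (∫f⁴ + 1)∕2` under a probability measure (`f² ≤ (f⁴+1)∕2`). [folklore] -/
theorem second_le_of_fourth {Ω : Type*} [MeasurableSpace Ω] {μ : Measure Ω} [IsProbabilityMeasure μ] {f : Ω → ℝ}
    (hf4 : Integrable (fun ω => f ω ^ 4) μ) : ∫ ω, f ω ^ 2 ∂μ ≤ ((∫ ω, f ω ^ 4 ∂μ) + 1) / 2 := by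
  have hb : Integrable (fun ω => (f ω ^ 4 + 1) / 2) μ := (hf4.add (integrable_const 1)).div_const 2
  have h := integral_mono_of_nonneg (μ := μ) (ae_of_all _ fun ω => sq_nonneg (f ω)) hb
    (ae_of_all _ fun ω => (by nlinarith [sq_nonneg (f ω ^ 2 - 1)] : f ω ^ 2 ≤ (f ω ^ 4 + 1) / 2))
  refine h.trans (le_of_eq ?_)
  rw [integral_div, integral_add hf4 (integrable_const 1), integral_const, probReal_univ, one_smul]

/-! ## §2. THE END: the whitened fourth cumulant's tree bound -/

variable {ι κ : Type} [Fintype ι] [DecidableEq ι] [Fintype κ] [DecidableEq κ]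

variable {U : EuclideanSpace ℝ ι → ℝ} {U' : EuclideanSpace ℝ ι → EuclideanSpace ℝ ι →L[ℝ] ℝ}
  {U'' : EuclideanSpace ℝ ι → EuclideanSpace ℝ ι →L[ℝ] EuclideanSpace ℝ ι →L[ℝ] ℝ} {Hk : ι → ι → ℝ} {A : Matrix ι κ ℝ} {D : κ → κ → ℝ}
  {γop κ₀ κ₁ κ₂ a τ δ θp lam lamA αr αc hr γ dθ dθ' αθ βθ M₆ : ℝ} {θ : κ → κ → ℝ} {σ : ι → κ → ℝ} {r : ι → ι → ℝ}

/-- **THE END — TREE DECAY OF THE WHITENED FOURTH CUMULANT, GENERAL `Γ = AAᵀ`** (the sixth centred moment `M₆` a letter). [folklore] -/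
theorem whitened_fourth_cumulant_tree [Nonempty κ] (hΓop : (γop • (1 : Matrix ι ι ℝ) - A * Aᵀ).PosSemidef) (Y : Finset ι)
    (hUd : ∀ φ : EuclideanSpace ℝ ι, HasFDerivAt U (U' φ) φ) (hU'd : ∀ φ : EuclideanSpace ℝ ι, HasFDerivAt U' (U'' φ) φ)
    (hU''c : Continuous U'') (hκ₀ : 0 ≤ κ₀) (hκ₁ : 0 ≤ κ₁) (ha : 0 ≤ a) (hτ : 0 < τ) (hδ : 0 < δ) (hθ0 : 0 < θp) (hθ1 : θp < 1)
    (hκθ : (2 * κ₀ * (1 + τ) + 4 * δ) * γop ≤ θp) (hκθw : 2 * κ₀ * (1 + τ) * γop + 4 * δ ≤ θp)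
    (hstab : ∀ φ : EuclideanSpace ℝ ι, -(κ₀ * ∑ x ∈ Y, φ x ^ 2) ≤ U φ)
    (hU'b : ∀ φ : EuclideanSpace ℝ ι, ‖U' φ‖ ≤ κ₁ * (a + ∑ x ∈ Y, φ x ^ 2)) (hU''b : ∀ φ : EuclideanSpace ℝ ι, ‖U'' φ‖ ≤ κ₂) (hlam : 0 ≤ lam)
    (hUsec : ∀ s : ℝ, 0 ≤ s → s ≤ 1 → ∀ a b : EuclideanSpace ℝ ι,
      U ((1 - s) • a + s • b) - lam / 2 * (s * (1 - s)) * ∑ i, (a i - b i) ^ 2 ≤ (1 - s) * U a + s * U b)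
    (hρg : lam * γop < 1)
    (hHk : ∀ (φ : EuclideanSpace ℝ ι) (x z : ι), |U'' φ (EuclideanSpace.single z (1 : ℝ)) (EuclideanSpace.single x (1 : ℝ))| ≤ Hk x z)
    (hHk0 : ∀ v u, 0 ≤ Hk v u) (ψ : EuclideanSpace ℝ ι)
    (hαr : ∀ u, ∑ w, |A u w| ≤ αr) (hαc : ∀ w, ∑ u, |A u w| ≤ αc) (hhr : ∀ v, ∑ u, Hk v u ≤ hr)
    (hlamA : ∀ x : κ, ∑ u, ∑ v, |A u x| * |A v x| * Hk v u ≤ lamA) (hlamA1 : lamA < 1) (hγ : αc * hr * αr / (1 - lamA) ≤ γ) (hγ1 : γ < 1)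
    -- the admissible `D` with weighted letters, the weights, the weighted profiles
    (hD : ∀ x y, 0 ≤ D x y)
    (hDC : ∀ x y, (if x = y then (1 : ℝ) else 0) + ∑ z, D x z * ((if y = z then 0 else ∑ u, ∑ v, |A u y| * |A v z| * Hk v u) / (1 - lamA)) ≤ D x y)
    (hθnn : ∀ z w, 0 ≤ θ z w) (hDr : ∀ z, ∑ w, D z w * θ z w ≤ dθ) (hdθ : 0 ≤ dθ) (hDc : ∀ w, ∑ z, D z w * θ z w ≤ dθ') (hdθ' : 0 ≤ dθ')
    (hσ0 : ∀ x w, 0 ≤ σ x w) (hσθ : ∀ x z w, σ x w ≤ σ x z * θ z w) (hr1 : ∀ x y, 1 ≤ r x y) (hrσ : ∀ x y w, r x y ^ 24 ≤ σ x w * σ y w)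
    (haσ : ∀ v : ι, ∑ w, (∑ u, |A u w| * Hk v u) * σ v w ≤ αθ) (hβ : 0 ≤ βθ) (haσ' : ∀ (v : ι) (w : κ), (∑ u, |A u w| * Hk v u) * σ v w ≤ βθ)
    -- the sixth-moment letter
    (hI6 : ∀ (v : ι) (c : ℝ), Integrable (fun z : κ → ℝ => (U' (matrixCLM A (WithLp.toLp 2 z) + ψ) (EuclideanSpace.single v (1 : ℝ)) - c) ^ 6)
        ((volume : Measure (κ → ℝ)).tilted fun z => -(1 / 2 * (z ⬝ᵥ z) + U (matrixCLM A (WithLp.toLp 2 z) + ψ))))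
    (hM6 : ∀ v : ι, ∫ w, (U' (matrixCLM A (WithLp.toLp 2 w) + ψ) (EuclideanSpace.single v (1 : ℝ)) - (∫ w', U' (matrixCLM A (WithLp.toLp 2 w') + ψ)
        (EuclideanSpace.single v (1 : ℝ)) ∂((volume : Measure (κ → ℝ)).tilted fun z => -(1 / 2 * (z ⬝ᵥ z) + U (matrixCLM A (WithLp.toLp 2 z) + ψ)))))
        ^ 6 ∂((volume : Measure (κ → ℝ)).tilted fun z => -(1 / 2 * (z ⬝ᵥ z) + U (matrixCLM A (WithLp.toLp 2 z) + ψ))) ≤ M₆)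
    (x y z t : ι) :
    |(∫ w, (U' (matrixCLM A (WithLp.toLp 2 w) + ψ) (EuclideanSpace.single x (1 : ℝ)) - (∫ w', U' (matrixCLM A (WithLp.toLp 2 w') + ψ)
        (EuclideanSpace.single x (1 : ℝ)) ∂((volume : Measure (κ → ℝ)).tilted fun z => -(1 / 2 * (z ⬝ᵥ z) + U (matrixCLM A (WithLp.toLp 2 z) + ψ)))))
        * (U' (matrixCLM A (WithLp.toLp 2 w) + ψ) (EuclideanSpace.single y (1 : ℝ)) - (∫ w', U' (matrixCLM A (WithLp.toLp 2 w') + ψ)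
        (EuclideanSpace.single y (1 : ℝ)) ∂((volume : Measure (κ → ℝ)).tilted fun z => -(1 / 2 * (z ⬝ᵥ z) + U (matrixCLM A (WithLp.toLp 2 z) + ψ)))))
        * (U' (matrixCLM A (WithLp.toLp 2 w) + ψ) (EuclideanSpace.single z (1 : ℝ)) - (∫ w', U' (matrixCLM A (WithLp.toLp 2 w') + ψ)
        (EuclideanSpace.single z (1 : ℝ)) ∂((volume : Measure (κ → ℝ)).tilted fun z => -(1 / 2 * (z ⬝ᵥ z) + U (matrixCLM A (WithLp.toLp 2 z) + ψ)))))
        * (U' (matrixCLM A (WithLp.toLp 2 w) + ψ) (EuclideanSpace.single t (1 : ℝ)) - (∫ w', U' (matrixCLM A (WithLp.toLp 2 w') + ψ)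
        (EuclideanSpace.single t (1 : ℝ)) ∂((volume : Measure (κ → ℝ)).tilted fun z => -(1 / 2 * (z ⬝ᵥ z) + U (matrixCLM A (WithLp.toLp 2 z) + ψ)))))
        ∂((volume : Measure (κ → ℝ)).tilted fun z => -(1 / 2 * (z ⬝ᵥ z) + U (matrixCLM A (WithLp.toLp 2 z) + ψ)))) - (∫ w, (U' (matrixCLM A
        (WithLp.toLp 2 w) + ψ) (EuclideanSpace.single x (1 : ℝ)) - (∫ w', U' (matrixCLM A (WithLp.toLp 2 w') + ψ) (EuclideanSpace.single x (1 : ℝ))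
        ∂((volume : Measure (κ → ℝ)).tilted fun z => -(1 / 2 * (z ⬝ᵥ z) + U (matrixCLM A (WithLp.toLp 2 z) + ψ))))) * (U' (matrixCLM A (WithLp.toLp 2
        w) + ψ) (EuclideanSpace.single y (1 : ℝ)) - (∫ w', U' (matrixCLM A (WithLp.toLp 2 w') + ψ) (EuclideanSpace.single y (1 : ℝ)) ∂((volume :
        Measure (κ → ℝ)).tilted fun z => -(1 / 2 * (z ⬝ᵥ z) + U (matrixCLM A (WithLp.toLp 2 z) + ψ))))) ∂((volume : Measure (κ → ℝ)).tilted fun z =>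
        -(1 / 2 * (z ⬝ᵥ z) + U (matrixCLM A (WithLp.toLp 2 z) + ψ)))) * (∫ w, (U' (matrixCLM A (WithLp.toLp 2 w) + ψ) (EuclideanSpace.single z (1 :
        ℝ)) - (∫ w', U' (matrixCLM A (WithLp.toLp 2 w') + ψ) (EuclideanSpace.single z (1 : ℝ)) ∂((volume : Measure (κ → ℝ)).tilted fun z => -(1 / 2 *
        (z ⬝ᵥ z) + U (matrixCLM A (WithLp.toLp 2 z) + ψ))))) * (U' (matrixCLM A (WithLp.toLp 2 w) + ψ) (EuclideanSpace.single t (1 : ℝ)) - (∫ w', U'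
        (matrixCLM A (WithLp.toLp 2 w') + ψ) (EuclideanSpace.single t (1 : ℝ)) ∂((volume : Measure (κ → ℝ)).tilted fun z => -(1 / 2 * (z ⬝ᵥ z) + U
        (matrixCLM A (WithLp.toLp 2 z) + ψ))))) ∂((volume : Measure (κ → ℝ)).tilted fun z => -(1 / 2 * (z ⬝ᵥ z) + U (matrixCLM A (WithLp.toLp 2 z) +
        ψ)))) - (∫ w, (U' (matrixCLM A (WithLp.toLp 2 w) + ψ) (EuclideanSpace.single x (1 : ℝ)) - (∫ w', U' (matrixCLM A (WithLp.toLp 2 w') + ψ)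
        (EuclideanSpace.single x (1 : ℝ)) ∂((volume : Measure (κ → ℝ)).tilted fun z => -(1 / 2 * (z ⬝ᵥ z) + U (matrixCLM A (WithLp.toLp 2 z) + ψ)))))
        * (U' (matrixCLM A (WithLp.toLp 2 w) + ψ) (EuclideanSpace.single z (1 : ℝ)) - (∫ w', U' (matrixCLM A (WithLp.toLp 2 w') + ψ)
        (EuclideanSpace.single z (1 : ℝ)) ∂((volume : Measure (κ → ℝ)).tilted fun z => -(1 / 2 * (z ⬝ᵥ z) + U (matrixCLM A (WithLp.toLp 2 z) + ψ)))))
        ∂((volume : Measure (κ → ℝ)).tilted fun z => -(1 / 2 * (z ⬝ᵥ z) + U (matrixCLM A (WithLp.toLp 2 z) + ψ)))) * (∫ w, (U' (matrixCLM A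
        (WithLp.toLp 2 w) + ψ) (EuclideanSpace.single y (1 : ℝ)) - (∫ w', U' (matrixCLM A (WithLp.toLp 2 w') + ψ) (EuclideanSpace.single y (1 : ℝ))
        ∂((volume : Measure (κ → ℝ)).tilted fun z => -(1 / 2 * (z ⬝ᵥ z) + U (matrixCLM A (WithLp.toLp 2 z) + ψ))))) * (U' (matrixCLM A (WithLp.toLp 2
        w) + ψ) (EuclideanSpace.single t (1 : ℝ)) - (∫ w', U' (matrixCLM A (WithLp.toLp 2 w') + ψ) (EuclideanSpace.single t (1 : ℝ)) ∂((volume :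
        Measure (κ → ℝ)).tilted fun z => -(1 / 2 * (z ⬝ᵥ z) + U (matrixCLM A (WithLp.toLp 2 z) + ψ))))) ∂((volume : Measure (κ → ℝ)).tilted fun z =>
        -(1 / 2 * (z ⬝ᵥ z) + U (matrixCLM A (WithLp.toLp 2 z) + ψ)))) - (∫ w, (U' (matrixCLM A (WithLp.toLp 2 w) + ψ) (EuclideanSpace.single x (1 :
        ℝ)) - (∫ w', U' (matrixCLM A (WithLp.toLp 2 w') + ψ) (EuclideanSpace.single x (1 : ℝ)) ∂((volume : Measure (κ → ℝ)).tilted fun z => -(1 / 2 *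
        (z ⬝ᵥ z) + U (matrixCLM A (WithLp.toLp 2 z) + ψ))))) * (U' (matrixCLM A (WithLp.toLp 2 w) + ψ) (EuclideanSpace.single t (1 : ℝ)) - (∫ w', U'
        (matrixCLM A (WithLp.toLp 2 w') + ψ) (EuclideanSpace.single t (1 : ℝ)) ∂((volume : Measure (κ → ℝ)).tilted fun z => -(1 / 2 * (z ⬝ᵥ z) + U
        (matrixCLM A (WithLp.toLp 2 z) + ψ))))) ∂((volume : Measure (κ → ℝ)).tilted fun z => -(1 / 2 * (z ⬝ᵥ z) + U (matrixCLM A (WithLp.toLp 2 z) +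
        ψ)))) * (∫ w, (U' (matrixCLM A (WithLp.toLp 2 w) + ψ) (EuclideanSpace.single y (1 : ℝ)) - (∫ w', U' (matrixCLM A (WithLp.toLp 2 w') + ψ)
        (EuclideanSpace.single y (1 : ℝ)) ∂((volume : Measure (κ → ℝ)).tilted fun z => -(1 / 2 * (z ⬝ᵥ z) + U (matrixCLM A (WithLp.toLp 2 z) + ψ)))))
        * (U' (matrixCLM A (WithLp.toLp 2 w) + ψ) (EuclideanSpace.single z (1 : ℝ)) - (∫ w', U' (matrixCLM A (WithLp.toLp 2 w') + ψ)
        (EuclideanSpace.single z (1 : ℝ)) ∂((volume : Measure (κ → ℝ)).tilted fun z => -(1 / 2 * (z ⬝ᵥ z) + U (matrixCLM A (WithLp.toLp 2 z) + ψ)))))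
        ∂((volume : Measure (κ → ℝ)).tilted fun z => -(1 / 2 * (z ⬝ᵥ z) + U (matrixCLM A (WithLp.toLp 2 z) + ψ))))| ≤
      (4 * (αθ * dθ * (βθ * dθ') / (1 - lamA)) + 3 * (αθ * dθ * (βθ * dθ') / (1 - lamA)) ^ 2 + 4 * (5 * (κ₂ ^ 4 * γop ^ 2) / (1 - lam * γop) ^ 2) + 4
          * M₆ + 2 * (((5 * (κ₂ ^ 4 * γop ^ 2) / (1 - lam * γop) ^ 2) + 1) / 2) * ((((5 * (κ₂ ^ 4 * γop ^ 2) / (1 - lam * γop) ^ 2) + 1) / 2) + (5 *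
          (κ₂ ^ 4 * γop ^ 2) / (1 - lam * γop) ^ 2))) *
        ((r x y ^ 2)⁻¹ * (r x z ^ 2)⁻¹ * (r x t ^ 2)⁻¹ + (r x y ^ 2)⁻¹ * (r y z ^ 2)⁻¹ * (r y t ^ 2)⁻¹ + (r x z ^ 2)⁻¹ * (r y z ^ 2)⁻¹ * (r z t ^
            2)⁻¹ + (r x t ^ 2)⁻¹ * (r y t ^ 2)⁻¹ * (r z t ^ 2)⁻¹ + (r x y ^ 2)⁻¹ * (r y z ^ 2)⁻¹ * (r z t ^ 2)⁻¹ + (r x y ^ 2)⁻¹ * (r y t ^ 2)⁻¹ * (r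
            z t ^ 2)⁻¹ + (r x z ^ 2)⁻¹ * (r y z ^ 2)⁻¹ * (r y t ^ 2)⁻¹ + (r x z ^ 2)⁻¹ * (r y t ^ 2)⁻¹ * (r z t ^ 2)⁻¹ + (r x t ^ 2)⁻¹ * (r y z ^
            2)⁻¹ * (r y t ^ 2)⁻¹ + (r x t ^ 2)⁻¹ * (r y z ^ 2)⁻¹ * (r z t ^ 2)⁻¹ + (r x y ^ 2)⁻¹ * (r x z ^ 2)⁻¹ * (r z t ^ 2)⁻¹ + (r x y ^ 2)⁻¹ * (r
            x t ^ 2)⁻¹ * (r z t ^ 2)⁻¹ + (r x y ^ 2)⁻¹ * (r x z ^ 2)⁻¹ * (r y t ^ 2)⁻¹ + (r x z ^ 2)⁻¹ * (r x t ^ 2)⁻¹ * (r y t ^ 2)⁻¹ + (r x y ^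
            2)⁻¹ * (r x t ^ 2)⁻¹ * (r y z ^ 2)⁻¹ + (r x z ^ 2)⁻¹ * (r x t ^ 2)⁻¹ * (r y z ^ 2)⁻¹) := by
  haveI : Nonempty ι := ⟨x⟩
  obtain ⟨w₀⟩ := ‹Nonempty κ›
  have hUc : Continuous U := continuous_iff_continuousAt.2 fun φ => (hUd φ).continuousAt
  have hl1 : 0 < 1 - lamA := by linarith
  have hcpos : ∀ _x : κ, 0 < 1 - lamA := fun _ => hl1
  have hκθ₀ : 2 * κ₀ * (1 + τ) * γop ≤ θp := SupEffectiveActionDerivative.mul_opBound_le_of_le (by positivity) (by linarith) hθ0.le hκθ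
  -- Dobrushin's plain row condition from the letters
  have hrow : ∀ x : κ, ∑ w, (if w = x then 0 else ∑ u, ∑ v, |A u w| * |A v x| * Hk v u) / (1 - lamA) ≤ γ := fun x => by
    rw [← Finset.sum_div]
    refine le_trans (div_le_div_of_nonneg_right ?_ hl1.le) hγ
    refine le_trans (Finset.sum_le_sum fun w _ => ?_) (whitened_J_rowsum_le hHk0 hαr hαc hhr x)
    split_ifs
    · exact le_rfl
    · linarith [abs_nonneg ((1 : Matrix κ κ ℝ) x w)]
  have hγ0 : 0 ≤ γ := by
    refine le_trans (Finset.sum_nonneg fun w _ => div_nonneg ?_ hl1.le) (hrow w₀)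
    split_ifs
    · exact le_rfl
    · exact whitened_cross_nonneg hHk0 A w₀ w
  -- the moment letters of (447) in Lebesgue form
  have hI0 := whitened_exp_integrable hΓop Y hUc.measurable hκ₀ hτ hθ1 hκθ₀ hstab ψ
  have hI2 := fun w => whitened_second_moment_integrable hΓop Y hUc.measurable hκ₀ hτ hδ hθ1 hκθw hstab ψ w
  have hV0 : Integrable (fun z : κ → ℝ => exp (-(1 / 2 * (z ⬝ᵥ z) + U (matrixCLM A (WithLp.toLp 2 z) + ψ)))) := by
    have h := whitened_integrable_lebesgue A ψ (k := fun _ => (1 : ℝ)) (by simpa only [mul_one] using hI0)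
    simpa only [one_mul] using h
  have hV2 : ∀ w, Integrable (fun z : κ → ℝ => z w ^ 2 * exp (-(1 / 2 * (z ⬝ᵥ z) + U (matrixCLM A (WithLp.toLp 2 z) + ψ)))) := fun w => by
    have h := whitened_integrable_lebesgue A ψ (k := fun ξ : EuclideanSpace ℝ κ => ξ w ^ 2) (hI2 w)
    simpa only [PiLp.toLp_apply] using h
  haveI : IsProbabilityMeasure ((volume : Measure (κ → ℝ)).tilted fun z => -(1 / 2 * (z ⬝ᵥ z) + U (matrixCLM A (WithLp.toLp 2 z) + ψ))) :=
      isProbabilityMeasure_tilted hV0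
  have hJ : ∀ x w : κ, 0 ≤ (if w = x then (0 : ℝ) else ∑ u, ∑ v, |A u w| * |A v x| * Hk v u) := fun x w => by
    split_ifs
    · exact le_rfl
    · exact whitened_cross_nonneg hHk0 A x w
  -- the decay of `B(b^v,b^{v′})` ((466), with `ρ := r²⁴`)
  have hK : 0 ≤ (αθ * dθ * (βθ * dθ') / (1 - lamA)) := by
    have hαθ : 0 ≤ αθ := le_trans (Finset.sum_nonneg fun w _ => mul_nonneg (whitened_obs_nonneg hHk0 A x w) (hσ0 x w)) (haσ x)
    positivity
  have hB : ∀ v v' : ι, ∑ w, (∑ z', D z' w * ∑ u, |A u z'| * Hk v u) * (∑ z', D z' w * ∑ u, |A u z'| * Hk v' u) / (1 - lamA) ≤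
      (αθ * dθ * (βθ * dθ') / (1 - lamA)) / r v v' ^ 24 := fun v v' => by
    have h := cross_bilinear_decay (D := D) (θ := θ) (σ := σ) (ρ := fun x y => r x y ^ 24) (c := fun _ => 1 - lamA)
      (a := fun w => ∑ u, |A u w| * Hk v u) (b := fun w => ∑ u, |A u w| * Hk v' u) hD hθnn hσ0 hσθ (fun x y w => hrσ x y w)
      (fun x y => one_le_pow₀ (hr1 x y)) hDr hdθ hDc hdθ' hl1 (fun _ => le_rfl) (fun w => whitened_obs_nonneg hHk0 A v w)
      (fun w => whitened_obs_nonneg hHk0 A v' w) v v' (haσ v) hβ (haσ' v')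
    rw [div_mul_eq_div_div] at h
    exact h
  -- the moments ((465); `M₂` from `M₄`)
  have h4 := fun v => whitened_fourth_moment_gibbs hΓop Y hUd hU'd hU''c hκ₀ hκ₁ ha hτ hδ hθ0 hθ1 hκθ hstab hU'b hU''b hlam hUsec hρg ψ v
  have hI4 := fun v c => whitened_fourth_power_integrable hΓop Y hUd hU'd hκ₀ hκ₁ ha hτ hδ hθ0 hθ1 hκθ hstab hU'b ψ v c
  have h2 : ∀ v : ι, ∫ w, (U' (matrixCLM A (WithLp.toLp 2 w) + ψ) (EuclideanSpace.single v (1 : ℝ)) - (∫ w', U' (matrixCLM A (WithLp.toLp 2 w') + ψ)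
      (EuclideanSpace.single v (1 : ℝ)) ∂((volume : Measure (κ → ℝ)).tilted fun z => -(1 / 2 * (z ⬝ᵥ z) + U (matrixCLM A (WithLp.toLp 2 z) + ψ))))) ^
      2 ∂((volume : Measure (κ → ℝ)).tilted fun z => -(1 / 2 * (z ⬝ᵥ z) + U (matrixCLM A (WithLp.toLp 2 z) + ψ))) ≤ (((5 * (κ₂ ^ 4 * γop ^ 2) / (1 -
      lam * γop) ^ 2) + 1) / 2) := fun v => by
    refine (second_le_of_fourth (hI4 v _)).trans ?_
    have := h4 v
    linarith
  -- (496) with everything written out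
  exact fourth_cumulant_tree_bound
    (P := fun x F ω => (∫ s, F (update ω x s) * exp (-(1 / 2 * (update ω x s ⬝ᵥ update ω x s) + U (matrixCLM A (WithLp.toLp 2 (update ω x s)) + ψ))))
        /
      ∫ s, exp (-(1 / 2 * (update ω x s ⬝ᵥ update ω x s) + U (matrixCLM A (WithLp.toLp 2 (update ω x s)) + ψ))))
    (V := fun z => 1 / 2 * (z ⬝ᵥ z) + U (matrixCLM A (WithLp.toLp 2 z) + ψ))
    (V₁ := fun x z => z x + U' (matrixCLM A (WithLp.toLp 2 z) + ψ) (matrixCLM A (EuclideanSpace.single x (1 : ℝ))))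
    (c := fun _ => 1 - lamA) (Cw := 1 + lamA) (J := fun x w => if w = x then 0 else ∑ u, ∑ v, |A u w| * |A v x| * Hk v u) (γ := γ) (D := D)
    (F₁ := fun w => U' (matrixCLM A (WithLp.toLp 2 w) + ψ) (EuclideanSpace.single x (1 : ℝ))) (F₂ := fun w => U' (matrixCLM A (WithLp.toLp 2 w) + ψ)
        (EuclideanSpace.single y (1 : ℝ)))
    (F₃ := fun w => U' (matrixCLM A (WithLp.toLp 2 w) + ψ) (EuclideanSpace.single z (1 : ℝ))) (F₄ := fun w => U' (matrixCLM A (WithLp.toLp 2 w) + ψ)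
        (EuclideanSpace.single t (1 : ℝ)))
    (a₁ := fun w => ∑ u, |A u w| * Hk x u) (a₂ := fun w => ∑ u, |A u w| * Hk y u) (a₃ := fun w => ∑ u, |A u w| * Hk z u)
    (a₄ := fun w => ∑ u, |A u w| * Hk t u)
    (fun _ _ _ => rfl) (fun x z => whitenedV_hasDerivAt hUd A ψ x z) (fun x z s s' => whitenedV_floor hU'd hHk A hlamA ψ x z s s') hcpos
    (fun x z s s' => whitenedV_ceiling hU'd hHk A hlamA ψ x z s s')
    (fun x w hw z s s' => by rw [if_neg hw]; exact whitenedV_cross hU'd hHk A ψ x w hw z s s')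
    (whitenedV_continuous hUd A ψ) hV0 hV2 hJ (fun x => by simp) hrow hγ0 hγ1 hD hDC
    (fun w z' s s' => whitened_obs_lipVec hU'd hHk A ψ x w z' s s') (fun w z' s s' => whitened_obs_lipVec hU'd hHk A ψ y w z' s s')
    (fun w z' s s' => whitened_obs_lipVec hU'd hHk A ψ z w z' s s') (fun w z' s s' => whitened_obs_lipVec hU'd hHk A ψ t w z' s s')
    hK (hr1 x y) (hr1 x z) (hr1 x t) (hr1 y z) (hr1 y t) (hr1 z t) (hB x y) (hB x z) (hB x t) (hB y z) (hB y t) (hB z t)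
    (hI4 x _) (hI6 x _) (h2 x) (h4 x) (hM6 x) (hI4 y _) (hI6 y _) (h2 y) (h4 y) (hM6 y) (hI4 z _) (hI6 z _) (h2 z) (h4 z) (hM6 z)
    (hI4 t _) (hI6 t _) (h2 t) (h4 t) (hM6 t)

/-! ## §3. Toy -/

/-- Toy (§1 in numbers, a Dirac mass at `f = 1`): `1 ≤ (1 + 1)∕2`. -/
example : (1 : ℝ) ^ 2 ≤ ((1 : ℝ) ^ 4 + 1) / 2 := by norm_num

end Summit.QuantumFields.BalabanUV.T4Continuum.NE7b.SupWhitenedFourthCumulantTree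

end
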